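import Literature.MathematicalPhysics.QuantumFieldTheory.Balaban1983to89.B8SectGH

/-!
# `Balaban1983to89.B8Carve04Props6to8Hyp` — [Balaban1985RegularSpaces] pp. 96–101 (end of Sect. E, Sects. F, G, H:
# Propositions 6–7, Theorem 8, the Claim of p. 97, displays (1.115)–(1.147)) CARVED IN HYPOTHESIS FORM — the residual
# printed statements of these six pages that had no declaration, and ONE bundle `B8Carve04Props6to8Hyp.Hyp` conjoining the
# section's printed statements BY NAME (P6 carving fan, block 04; key item stmt-QuantumFields-19200, also feeds 20541)

statement-level skeleton of published theorems with citation tags; proofs where landed; nothing here is a claim about the Yang–Mills mass gap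

CITATION HEADER.  T. Bałaban, *Spaces of regular gauge field configurations on a lattice and gauge fixing conditions*,
Commun. Math. Phys. **99** (1985) 75–102 [Balaban1985RegularSpaces] (cell paper B8; "[4]" = [Balaban1985BackgroundPropagators],
whose (3.35) p. 396 is the «regularity condition (3.35) in [4]» of (1.33)).  PDF held: `paper:balaban1985-cmp99-regular-spaces-gauge-fixing`
(journal page = PDF page + 74); pp. 96–101 = PDF 22–27 re-read first-hand on the renders
`pub-balaban/b2b-balaban-ref1/pages/…/1985-cmp99-regular-spaces-gauge-fixing-p022…p027-x2.png`; the locators «p. N l. a–b» below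
count text lines of those renders (displays counted as lines).  The paper is a MANUSCRIPT UNDER ADJUDICATION in this tree: every
`def … : Prop` below is a PRINTED statement typed as a proposition to be used as a HYPOTHESIS `(h : …)`; every `theorem` is
kernel-checked bookkeeping between typed forms or real arithmetic of printed constants.  WHAT IS REPRODUCED = SKELETON rows
B8.Eq1.121, Eq1.125, Claim@97, Eq1.127–Eq1.134, Prop6, Eq1.140, Eq1.141, Prop7, Eq1.146, Thm8 (all IN TREE — cited, not restated)
plus the residual sentences listed under WHAT THIS FILE ADDS.  Unit `lit-balaban-carve-04` (HOME `run/shared/lean/pub/lit-balaban/carve/`,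
rules `carve/CARVE-RULES.md`, block table `carve/BLOCKS-01-10.md`); ONE import (`…B8SectGH`, hence `…B8`); nothing in the tree is edited.

## IN TREE = CITED (the printed items of pp. 96–101 that already have declarations; NOT restated here)

* p. 96 (1.115)–(1.118), p. 97 ll. 9–13 (∃! solution of (1.117), `D′(λ)`, «|D′(λ)| = |C′(λ − H′D′(λ))| < C′₂(α₃ + α₄)α₄»):
  `B8SectEStatements.Eq1117`, `eq1117_existsUnique` (whose hypothesis `hsm` IS the printed «contractive if e.g. α₃ + α₄ ≤ 1/(4B′₀C′₂)»,
  p. 97 l. 7, and whose self-map step IS p. 96 ll. 19–21 «maps the set (1.119) of X's into itself if C′₂(α₃ + α₄)α₄ ≤ α₄/(2B′₀), or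
  α₃ + α₄ ≤ 1/(2B′₀C′₂)»), `Dprime`, `Dprime_spec`, `Dprime_unique`, `Dprime_bound`, `linMap` ((1.113)), `eq1114_Dprime`
  ((1.115) ⇒ (1.114)); the arithmetic `B8SectE.b8_sectE_smallness`; «This solution is an analytic function of λ» (p. 97 l. 10):
  `B8Eq1117Analytic.Dprime_analyticAt` — typed over ℂ-linear data, which is also how p. 96 ll. 22–23 «We may admit configurations
  λ, X with values in the complexified algebra 𝔤ᶜ and all the above equations and inequalities are valid also» is covered (the
  abstract forms quantify over arbitrary real/complex normed spaces).
* p. 96 (1.119)–(1.121): row B8.Eq1.121 — `B8SectEStatements.norm_arg_lt` ((1.120)), `B8Eq1117Concrete.dom120_of_119`, `norm_Cnl_le_of207`.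
* pp. 96–97 (1.122)–(1.125): row B8.Eq1.125 — `B8Ineq125.radius_keeps_domain`, `cauchy_weighted`, `ineq125_weighted`;
  `B8SectDSource.norm_fderiv_le_of_norm_le`; concrete `B8Eq1123Concrete.hasDerivAt_Cnl_line`.
* p. 97 ll. 14–16, the CLAIM «the mapping (1.113) transforms the set {λ : |λ| < ½α₄, |Dλ| < ½α₄(Lʲη)⁻¹ on Ω_j} onto a set containing
  {λ′ : |λ′| < ¼α₄, …}»: `B8Claim97OntoProof.linMap_onto_quarter` (PROVED; abstract step `B8SectE.onto_of_lipschitz_half`).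
* p. 97 (1.126)–(1.127) and the sentence «hence the configuration U₀^{u₀⁻¹} satisfies (1.126)»: row B8.Eq1.127 —
  `B8Eq1126AxialWitness.Holds126` ((1.126) typed), its located reading note (cell GAPS G-B8-18, constants only), and the
  bookkeeping `B8.thm2_exists_without_reg335`.
* p. 98 l. 1 «The configuration identically equal to 1 satisfies, of course, all possible regularity conditions»:
  `B8Prop6OfThm4.one_inAk` (𝔄_k) and `B8Eq133Hypotheses.reg335Zd_one` ((3.35) of [4]).
* p. 98 ll. 5–25, the cube geometry (□ ⊂ Ω_j of size MLʲη, M a multiple of R₁M₁; □₀ ⊃ … ⊃ □_k ⊃ □ at boundary distances R₁M₁Lʲη;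
  «Σ_{j=0}^{k} R₁M₁Lʲη < (1 − L⁻¹)⁻¹R₁M₁ ≤ 2R₁M₁»; □̃, «L⁻¹RM > 2dR₁M₁, thus we have □̃ ⊂ Ω_{k−1}»; compatibility with the block
  structure): `B8Eq131Cubes.box`, `cube`, `tcube`, `ctr`, `margin_collar`, `cube_subset_tcube`; `B8.sectF_collar_margin` (G-B8-15);
  `B8Ineq132.geom_margin`; `B8Eq131CubesAdmissible.cubeFam_domainSeq` (p. 99 ll. 4–5 «{□_j} is an admissible family … (1.3), (1.4)»);
  p. 98 ll. 11–13 «we can drop out the domains Ω_{j′}, j′ > j, from our assumptions»: `B8Thm4TruncationLocal.inAk_truncate`.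
* p. 98 (1.128): `B8Ineq130.ineq128_local`, `ineq128_global`; (1.129): `B8Ineq129.ineq129`, `B8Eq115GaugeFixing.gaugeFix_global`;
  p. 99 (1.130): `B8Ineq130.descent`, `ineq130` (last step ⇔ M > 11d: `B8.ineq130_iff`, G-B8-14); (1.131): `B8Eq131Cubes.LamP`;
  (1.132)–(1.133): `B8Ineq133.cutCfg`, `ineq133`, `B8Ineq132.ineq132`; p. 99 ll. 12–16 «If 7dL²Mα₀ ≤ c₁, then the assumptions of
  Theorem 4 are satisfied for the pair of configurations 1, U₀″ … (1.134)»: `B8Prop6OfThm4.smallness_134`, `prop6_of_thm4`,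
  `prop6_of_thm4_printed`, `B8.prop6_smallness_iff`; (1.137): `B8Prop6OfThm4.ineq137_cube`, `B8Ineq129.ineq137_log_printed`.
* p. 99 PROPOSITION 6 (1.135)–(1.138): `B8.Prop6Printed` (abstract leaf of record; in B9's shape `B8FromB9.prop6_in_B9_shape`,
  `smallness_conversion`).
* p. 100 (1.139)–(1.140): `B8SectGH.GFData3.C140` (all three members), `B8Eq140Level.Cond140`, `B8Prop7ClassAkLiteral.Cond140Lit`;
  (1.141): `B8Eq146AExpansion.norm_covPlaqF_expCfg_sub_one_le`, `B8Prop7ClassAkLocal` (which also absorbs «α₀ + 2α₂ + 8α₂² ≤ α₀ + 3α₂»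
  concretely); (1.142): `B8Eq151V2Divergence.eq154` read with (1.140), `B8Eq154Local`; (1.143): `B8Eq156Prop4.ineq1143`;
  p. 100 ll. 19–21 «a gauge transformation u satisfying the conditions (1.29) and such that the configuration U′ = (U₁U₀)ᵘU₀⁻¹
  satisfies the axial gauge conditions (1.19). This gauge transformation is determined uniquely»: abstracted as the map `toAxial` of
  `B8SectGH.Prop7PrintedR` / `B8.Prop7Printed`; concrete `B8Eq119TwistedAxial.twistedFix_global`, `twistedFix_unique_normalised`,
  `Restr129` ((1.29)), `InAx` ((1.19)).
* p. 100 PROPOSITION 7 (1.144)–(1.145): `B8SectGH.Prop7PrintedR` (faithful hypotheses), `B8.Prop7Printed` (r1, stronger),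
  `B8SectGH.prop7PrintedR_of_printed`; (1.145) bond class by bond class `B8Ineq145` (reading note G-adv8-16: constants only).
* p. 101 (1.146), «f from the space R(U₀) … R(U₀)f = f», «|f|_(−2) < γ(α₀ + α₁) … e.g. γ = 1»: `B8.GFData.LandauF`, `B8.GFData.fNorm`,
  `B8SectGH.GFData3.InR`; concrete `B8Thm8MultiLevelTorus.thm8_multiLevelTorus_V1`; p. 101 ll. 6–9 «Inspecting the proofs …»:
  `B8.Thm8Inspected`, `B8.thm8_exists_of_printed` (objection witnesses G-B8-13: `B8HessianSupWitness.no_uniform_sup_hessian_bound`).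
* p. 101 THEOREM 8: `B8SectGH.Thm8PrintedAt` (faithful, one γ), `B8SectGH.Thm8PrintedR`, `B8.Thm8Printed` (r1),
  `B8SectGH.thm8PrintedAt_one_of_printed`.

## WHAT THIS FILE ADDS (residual printed sentences with no declaration; hypothesis form; and the bundle)

* `SectFRemovalPrinted` — THE THESIS OF SECT. F: p. 82 (after (1.35)) «We will see later that this condition [(3.35) in (1.33)] is
  a consequence of the first one in (1.33), so eventually we will drop it out of the assumptions», p. 97 ll. 18–20 «the additional
  regularity assumption (3.35) in (1.33) is a consequence of the fundamental assumption U₀ ∈ 𝔄_k({Ω_j}, α₀)», p. 99 ll. 17–20 «hence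
  for α₀ sufficiently small we have proved the regularity condition (3.35). This implies that we can drop out this condition from
  the assumption (1.33).» — typed over the carrier of record `B8.GFData` (`InA α₀ U₀` = first clause of (1.33), `Reg335 α₀ U₀` =
  its second clause) with the printed threshold «for α₀ sufficiently small»; previously present only as the un-named, threshold-free
  binder `hreg` of `B8.thm2_exists_without_reg335` / `B8Ineq145.thm2_after_prop7RepairedC`.  Bookkeeping (kernel): Theorems 2, 4 and 8
  with the clause dropped — `thm2_dropReg335` (existence AND uniqueness, all of (1.36)–(1.39)), `thm4_dropReg335`, `thm8At_dropReg335`.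
* `SectFAlpha0RestrictionPrinted` — p. 98 ll. 35–40 «In particular this means α₀ ≤ O(1)M⁻¹, where O(1) has to be a small number. If
  we are proving the condition (3.35), then M = R₁M₁ and the restriction is α₀ ≤ O(1)(R₁M₁)⁻¹»; `prop6Hyp_iff_restriction`:
  Proposition 6's printed hypothesis «7dL²Mα₀ ≤ c₁» IS this restriction with O(1) = c₁/(7dL²).
* `SectGSimplificationPrinted` — p. 100 ll. 15–16 «To simplify formulations we assume that α₀, α₂ are so small that α₀ + 2α₂ + 8α₂²
  ≤ α₀ + 3α₂, α₀ + α₂ + 36dα₂² + 50dα₂³ + 10dα₀α₂ ≤ α₀ + 2α₂» (the passage from (1.141)–(1.142) to the constants α₀ + 3α₂, 2α₂ of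
  Proposition 7); `sectG_simplification_iff` (⟺ 8α₂ ≤ 1 ∧ 36dα₂ + 50dα₂² + 10dα₀ ≤ 1 for α₂ > 0), `sectG_simplification_of_small`
  (non-vacuity: 8α₂ ≤ 1 and 50d(α₀ + α₂) ≤ 1 suffice).
* `Hyp` (full name `…B8Carve04Props6to8Hyp.Hyp`) — THE BUNDLE keyed to the consumer: `SectFRemovalPrinted ∧ B8.Prop6Printed ∧ B8SectGH.Prop7PrintedR ∧
  B8SectGH.Thm8PrintedAt γ`, with ONE constant `B₁` feeding both Proposition 6 ((1.136) «7dL²B₁Mα₀», B₁ of Theorem 2) and Theorem 8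
  (p. 101 ll. 14–15 «The constants B₁, B₂(β₀) are as in Theorems 2, 4»); accessors `.sectF`, `.prop6`, `.prop7`, `.thm8` and the
  derived `.thm8_noReg335`, `.thm2_noReg335` (given block 02's `B8.Thm2Printed` on the same family).

## HONEST SCOPE / NOT TYPED

(i) p. 101 ll. 17–34, the Hölder regularity condition (1.147) and the announced «analog of Theorem 2» under it, are NOT typed: print
states them WITHOUT proof («Unfortunately a proof of this result is rather unelementary … We will not need the above generalization»)
— an unproved claim is not Literature (cell GAPS G-B8-09, `…B8` module docstring «it must never be cited»).  (ii) p. 100 ll. 27–31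
«This theorem complements Theorem 2 … a kind of isomorphism …» is prose whose mathematical content is Proposition 7 + Theorem 2; not
typed separately.  (iii) The clause «B₁, B₂(β₀) are as in Theorems 2, 4» is expressed INSIDE the bundle by the shared parameter `B₁`
(Prop. 6 / Thm 8) only; against `B8.Thm2Printed`, whose constants are existentially bound, it cannot be stated without restating
Theorem 2's body (not done; `B8Thm2AtConstants.thm2ExistsAt_of_bodies` is where the tree exposes Theorem 2's B₁ = 5dLB₀).  (iv) In
`SectFRemovalPrinted` the carrier's `Reg335 α₀` label absorbs print's O(1) of (3.35) (= 7dL²B₁ by (1.136) at M = R₁M₁; cf.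
`B8FromB9.smallness_conversion`), exactly as `…B8`'s `GFData` docstring reads (1.33); the same-α₀ indexing is the tree's convention
(`B8.thm2_exists_without_reg335`), the threshold «α₀ sufficiently small» is printed (p. 99 l. 18).  (v) The located reading notes
of these pages are inherited, not re-adjudicated: G-B8-18 ((1.126) transfer, constants), G-adv8-16 / D-pv17.4 ((1.145) on crossing
bonds; `Prop7PrintedR` types (1.145) through `avgClose`), G-B8-13 (Theorem 8's ∇- and Hölder clauses for rough f), G-B8-14 (M > 11d in
(1.130)).  (vi) No instance, no notation, no `sorry`; axioms standard.  Nothing here proves a summit statement or bears on the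
Clay problem; the node count does not move.
-/

namespace Literature.MathematicalPhysics.QuantumFieldTheory.Balaban1983to89.B8Carve04Props6to8Hyp

variable {I : Type}

/-! ## §1 Sect. F — the regularity clause «(3.35) in [4]» of (1.33) is a consequence of `U₀ ∈ 𝔄_k({Ω_j}, α₀)` -/

/-- **Sect. F, the removal of the additional regularity assumption** (p. 97 [PDF 23] ll. 18–20, verbatim): *"We will prove that the
additional regularity assumption (3.35) in (1.33) is a consequence of the fundamental assumption U₀ ∈ 𝔄_k({Ω_j}, α₀), thus of the
regularity conditions (1.7)–(1.9)."*; (p. 99 [PDF 25] ll. 17–20, verbatim): *"The configuration U₁ in a neighborhood of □ is obtained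
from U₀ by a gauge transformation, hence for α₀ sufficiently small we have proved the regularity condition (3.35).  This implies that
we can drop out this condition from the assumption (1.33)."*; announced p. 82 [PDF 8]: *"We need the second condition in (1.33) to apply
all the results of [4] on propagators with the background gauge field configuration U₀. We will see later that this condition is a
consequence of the first one in (1.33), so eventually we will drop it out of the assumptions."*  Typed over the carrier of record
`B8.GFData` of a family of geometric data (fixed d, L): `InA α₀ U₀` = «U₀ ∈ 𝔄_k({Ω_j}, α₀)» (first clause of (1.33)), `Reg335 α₀ U₀` =
«U₀ satisfies the regularity condition (3.35) in [4]» (second clause; the O(1) of (3.35) absorbed in the label, = 7dL²B₁ by (1.136) at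
M = R₁M₁), «for α₀ sufficiently small» = a threshold `c > 0` chosen before the instance (p. 98 ll. 37–40: α₀ ≤ O(1)(R₁M₁)⁻¹, «of the
same kind as the other restrictions on α₀»). [cite: Balaban1985RegularSpaces, Sect. F p.97 ll.18–20 + p.99 ll.17–20 + (1.33) p.82] -/
def SectFRemovalPrinted (fam : I → B8.GFData) : Prop :=
  ∃ c : ℝ, 0 < c ∧ ∀ i : I, ∀ α₀ : ℝ, 0 < α₀ → α₀ ≤ c →
    ∀ U₀ : (fam i).Cfg, (fam i).InA α₀ U₀ → (fam i).Reg335 α₀ U₀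

/-- **THEOREM 2 WITH THE CLAUSE (3.35) DROPPED** (p. 99 l. 20 «This implies that we can drop out this condition from the assumption
(1.33)» applied to Theorem 2 p. 83) — kernel bookkeeping: from `B8.Thm2Printed` (∃ B₁, B₂(β₀), c₁) and `SectFRemovalPrinted`
(threshold c) one gets Theorem 2's FULL conclusion — a (1.29)-restricted u with (1.36), (1.37), (1.38), (1.39) for U₁ = U′^{u⁻¹},
unique among such — for all U₀, U′U₀ with the FIRST clause of (1.33), (1.34), (1.35) and α₀ + α₁ ≤ min{c₁, c} (so α₀ ≤ c since α₁ > 0).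
The form in which the sequel papers use Theorem 2 (cf. the existence-only, threshold-free `B8.thm2_exists_without_reg335`).
[cite: Balaban1985RegularSpaces, Thm 2 p.83 with Sect. F p.99 l.20 (bookkeeping)] -/
theorem thm2_dropReg335 (fam : I → B8.GFData) (h2 : B8.Thm2Printed fam) (hF : SectFRemovalPrinted fam) :
    ∃ B₁ B₂ c₁ : ℝ, 0 < B₁ ∧ 0 < B₂ ∧ 0 < c₁ ∧
      ∀ i : I, ∀ α₀ α₁ : ℝ, 0 < α₀ → 0 < α₁ → α₀ + α₁ ≤ c₁ →
        ∀ U₀ : (fam i).Cfg, ∀ U' : (fam i).Pert,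
          (fam i).InA α₀ U₀ → (fam i).InAAx α₀ U₀ U' → (fam i).avgClose α₁ U₀ U' →
            ∃ u : (fam i).GT, (fam i).Restricted U₀ u ∧
              ((fam i).C136 B₁ B₂ (α₀ + α₁) U₀ ((fam i).act U' u) ∧ (fam i).C137 α₁ U₀ ((fam i).act U' u) ∧
                (fam i).Landau U₀ ((fam i).act U' u) ∧ (fam i).C139 B₁ (α₀ + α₁) U₀ ((fam i).act U' u)) ∧
              ∀ u' : (fam i).GT, (fam i).Restricted U₀ u' →
                (fam i).C136 B₁ B₂ (α₀ + α₁) U₀ ((fam i).act U' u') → (fam i).C137 α₁ U₀ ((fam i).act U' u') →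
                (fam i).Landau U₀ ((fam i).act U' u') → (fam i).C139 B₁ (α₀ + α₁) U₀ ((fam i).act U' u') →
                  u' = u := by
  obtain ⟨B₁, B₂, c₁, hB₁, hB₂, hc₁, H⟩ := h2
  obtain ⟨c, hc, HF⟩ := hF
  refine ⟨B₁, B₂, min c₁ c, hB₁, hB₂, lt_min hc₁ hc, fun i α₀ α₁ h0 h1 hs U₀ U' hA hAx hcl => ?_⟩
  have hs₁ : α₀ + α₁ ≤ c₁ := hs.trans (min_le_left _ _)
  have hα₀c : α₀ ≤ c := by linarith [min_le_right c₁ c]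
  exact H i α₀ α₁ h0 h1 hs₁ U₀ U' hA (HF i α₀ h0 hα₀c U₀ hA) hAx hcl

/-- **THEOREM 4 WITH THE CLAUSE (3.35) DROPPED** — the same bookkeeping for `B8.Thm4Printed B′₁` (p. 88: hypotheses (1.33), (1.34),
(1.66); conclusions (1.37), (1.38), (1.62), uniqueness): under `SectFRemovalPrinted` the second clause of (1.33) is discharged for
α₀ + α₁ ≤ min{c₁, c}. [cite: Balaban1985RegularSpaces, Thm 4 p.88 with Sect. F p.99 l.20 (bookkeeping)] -/
theorem thm4_dropReg335 (B₁' : ℝ) (fam : I → B8.GFData) (h4 : B8.Thm4Printed B₁' fam) (hF : SectFRemovalPrinted fam) :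
    ∃ c₁ : ℝ, 0 < c₁ ∧
      ∀ i : I, ∀ α₀ α₁ : ℝ, 0 < α₀ → 0 < α₁ → α₀ + α₁ ≤ c₁ →
        ∀ U₀ : (fam i).Cfg, ∀ U' : (fam i).Pert,
          (fam i).InA α₀ U₀ → (fam i).InAAx α₀ U₀ U' → (fam i).avgClose166 α₁ U₀ U' →
            ∃ u : (fam i).GT, (fam i).Restricted U₀ u ∧
              ((fam i).C137 α₁ U₀ ((fam i).act U' u) ∧ (fam i).Landau U₀ ((fam i).act U' u) ∧
                (fam i).C162 B₁' (α₀ + α₁) U₀ ((fam i).act U' u)) ∧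
              ∀ u' : (fam i).GT, (fam i).Restricted U₀ u' →
                (fam i).C137 α₁ U₀ ((fam i).act U' u') → (fam i).Landau U₀ ((fam i).act U' u') →
                (fam i).C162 B₁' (α₀ + α₁) U₀ ((fam i).act U' u') → u' = u := by
  obtain ⟨c₁, hc₁, H⟩ := h4
  obtain ⟨c, hc, HF⟩ := hF
  refine ⟨min c₁ c, lt_min hc₁ hc, fun i α₀ α₁ h0 h1 hs U₀ U' hA hAx hcl => ?_⟩
  have hs₁ : α₀ + α₁ ≤ c₁ := hs.trans (min_le_left _ _)
  have hα₀c : α₀ ≤ c := by linarith [min_le_right c₁ c]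
  exact H i α₀ α₁ h0 h1 hs₁ U₀ U' hA (HF i α₀ h0 hα₀c U₀ hA) hAx hcl

/-- **THEOREM 8 (at one γ) WITH THE CLAUSE (3.35) DROPPED** — the same bookkeeping for the faithful form `B8SectGH.Thm8PrintedAt γ B₁ B₂`
(p. 101: hypotheses (1.33)–(1.35), f ∈ R(U₀) with |f|_(−2) < γ(α₀ + α₁); conclusions (1.36), (1.37), (1.39), (1.146), uniqueness):
under `SectFRemovalPrinted` (on the underlying `B8.GFData` family) the second clause of (1.33) is discharged for α₀ + α₁ ≤ min{c₁, c}.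
[cite: Balaban1985RegularSpaces, Thm 8 p.101 with Sect. F p.99 l.20 (bookkeeping)] -/
theorem thm8At_dropReg335 (γ B₁ B₂ : ℝ) (fam : I → B8SectGH.GFData3) (h8 : B8SectGH.Thm8PrintedAt γ B₁ B₂ fam)
    (hF : SectFRemovalPrinted (fun i => (fam i).toGFData)) :
    ∃ c₁ : ℝ, 0 < c₁ ∧
      ∀ i : I, ∀ α₀ α₁ : ℝ, 0 < α₀ → 0 < α₁ → α₀ + α₁ ≤ c₁ →
        ∀ U₀ : (fam i).Cfg, ∀ U' : (fam i).Pert, ∀ f : (fam i).Src,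
          (fam i).InA α₀ U₀ → (fam i).InAAx α₀ U₀ U' → (fam i).avgClose α₁ U₀ U' →
          (fam i).InR U₀ f → (fam i).fNorm f < γ * (α₀ + α₁) →
            ∃ u : (fam i).GT, (fam i).Restricted U₀ u ∧
              ((fam i).C136 B₁ B₂ (α₀ + α₁) U₀ ((fam i).act U' u) ∧ (fam i).C137 α₁ U₀ ((fam i).act U' u) ∧
                (fam i).C139 B₁ (α₀ + α₁) U₀ ((fam i).act U' u) ∧ (fam i).LandauF U₀ f ((fam i).act U' u)) ∧
              ∀ u' : (fam i).GT, (fam i).Restricted U₀ u' →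
                (fam i).C136 B₁ B₂ (α₀ + α₁) U₀ ((fam i).act U' u') → (fam i).C137 α₁ U₀ ((fam i).act U' u') →
                (fam i).C139 B₁ (α₀ + α₁) U₀ ((fam i).act U' u') → (fam i).LandauF U₀ f ((fam i).act U' u') →
                  u' = u := by
  obtain ⟨c₁, hc₁, H⟩ := h8
  obtain ⟨c, hc, HF⟩ := hF
  refine ⟨min c₁ c, lt_min hc₁ hc, fun i α₀ α₁ h0 h1 hs U₀ U' f hA hAx hcl hInR hf => ?_⟩
  have hs₁ : α₀ + α₁ ≤ c₁ := hs.trans (min_le_left _ _)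
  have hα₀c : α₀ ≤ c := by linarith [min_le_right c₁ c]
  exact H i α₀ α₁ h0 h1 hs₁ U₀ U' f hA (HF i α₀ h0 hα₀c U₀ hA) hAx hcl hInR hf

/-! ## §2 Sect. F — the size restriction «α₀ ≤ O(1)M⁻¹» (p. 98) -/

/-- **The restriction on α₀ of Sect. F** (p. 98 [PDF 24] ll. 35–40, verbatim): *"We assume that α₀ is so small that the number on the
right-hand side above [(M + 4R₁M₁)dL²α₀ of (1.129)] is still small and all the theorems on averaging operations are valid. In
particular this means α₀ ≤ O(1)M⁻¹, where O(1) has to be a small number. If we are proving the condition (3.35), then M = R₁M₁ and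
the restriction is α₀ ≤ O(1)(R₁M₁)⁻¹. R₁, M₁ are absolute constants, hence the last restriction is of the same kind as the other
restrictions on α₀."* — the printed shape «α₀ ≤ O(1)M⁻¹» with the O(1) an explicit parameter `O₁` (M = the size parameter of the cube
□, p. 98 l. 11 «a size of □ equal to MLʲη»). [cite: Balaban1985RegularSpaces, p.98 ll.35–40 (after (1.129))] -/
def SectFAlpha0RestrictionPrinted (O₁ M α₀ : ℝ) : Prop :=
  α₀ ≤ O₁ * M⁻¹

/-- Kernel bookkeeping: Proposition 6's printed hypothesis «7dL²Mα₀ ≤ c₁» (p. 99 l. 22; the smallness slot of `B8.Prop6Printed`) IS a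
restriction of the printed kind «α₀ ≤ O(1)M⁻¹» with O(1) = c₁/(7dL²) (d, L, M > 0). [cite: Balaban1985RegularSpaces, p.98 ll.36–38 + Prop. 6 p.99 (arithmetic)] -/
theorem prop6Hyp_iff_restriction {d L M α₀ c₁ : ℝ} (hd : 0 < d) (hL : 0 < L) (hM : 0 < M) :
    7 * d * L ^ 2 * M * α₀ ≤ c₁ ↔ SectFAlpha0RestrictionPrinted (c₁ / (7 * d * L ^ 2)) M α₀ := by
  unfold SectFAlpha0RestrictionPrinted
  have hpos : 0 < 7 * d * L ^ 2 * M := by positivity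
  rw [← div_eq_mul_inv, div_div, le_div_iff₀ hpos, mul_comm α₀]

/-! ## §3 Sect. G — the simplifying smallness assumption behind the constants of Proposition 7 (p. 100) -/

/-- **The simplifying smallness assumption of Sect. G** (p. 100 [PDF 26] ll. 15–16, verbatim): *"To simplify formulations we assume
that α₀, α₂ are so small that α₀ + 2α₂ + 8α₂² ≤ α₀ + 3α₂, α₀ + α₂ + 36dα₂² + 50dα₂³ + 10dα₀α₂ ≤ α₀ + 2α₂."* — the two inequalities
turning the constants of (1.141) («(α₀ + 2α₂ + 8α₂²)L⁻²ʲ») and (1.142) («(α₀ + α₂ + 36dα₂² + 50dα₂³ + 10dα₀α₂)(Lʲη)⁻³η²») into the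
«α₀ + 3α₂» of (1.144) and the «2α₂»-type constants; part of Proposition 7's «for α₀, α₂ sufficiently small».
[cite: Balaban1985RegularSpaces, p.100 ll.15–16 (between (1.142) and (1.143))] -/
def SectGSimplificationPrinted (d α₀ α₂ : ℝ) : Prop :=
  α₀ + 2 * α₂ + 8 * α₂ ^ 2 ≤ α₀ + 3 * α₂ ∧
    α₀ + α₂ + 36 * d * α₂ ^ 2 + 50 * d * α₂ ^ 3 + 10 * d * α₀ * α₂ ≤ α₀ + 2 * α₂

/-- Kernel arithmetic: for α₂ > 0 the printed pair of inequalities is equivalent to «8α₂ ≤ 1» and «36dα₂ + 50dα₂² + 10dα₀ ≤ 1»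
(divide by α₂). [cite: Balaban1985RegularSpaces, p.100 ll.15–16 (arithmetic)] -/
theorem sectG_simplification_iff {d α₀ α₂ : ℝ} (hα₂ : 0 < α₂) :
    SectGSimplificationPrinted d α₀ α₂ ↔ 8 * α₂ ≤ 1 ∧ 36 * d * α₂ + 50 * d * α₂ ^ 2 + 10 * d * α₀ ≤ 1 := by
  have e₁ : 8 * α₂ * α₂ = 8 * α₂ ^ 2 := by ring
  have e₂ : (36 * d * α₂ + 50 * d * α₂ ^ 2 + 10 * d * α₀) * α₂ =
      36 * d * α₂ ^ 2 + 50 * d * α₂ ^ 3 + 10 * d * α₀ * α₂ := by ring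
  unfold SectGSimplificationPrinted
  constructor
  · rintro ⟨h₁, h₂⟩
    refine ⟨?_, ?_⟩
    · have h : 8 * α₂ * α₂ ≤ 1 * α₂ := by rw [e₁, one_mul]; linarith
      exact le_of_mul_le_mul_right h hα₂
    · have h : (36 * d * α₂ + 50 * d * α₂ ^ 2 + 10 * d * α₀) * α₂ ≤ 1 * α₂ := by rw [e₂, one_mul]; linarith
      exact le_of_mul_le_mul_right h hα₂
  · rintro ⟨h₁, h₂⟩
    refine ⟨?_, ?_⟩
    · have h := mul_le_mul_of_nonneg_right h₁ hα₂.le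
      rw [e₁, one_mul] at h
      linarith
    · have h := mul_le_mul_of_nonneg_right h₂ hα₂.le
      rw [e₂, one_mul] at h
      linarith

/-- Non-vacuity of the printed assumption («α₀, α₂ … so small that»): it holds as soon as 8α₂ ≤ 1 and 50d(α₀ + α₂) ≤ 1
(d, α₀ ≥ 0, α₂ > 0) — sufficient, not sharp. [cite: Balaban1985RegularSpaces, p.100 ll.15–16 (arithmetic)] -/
theorem sectG_simplification_of_small {d α₀ α₂ : ℝ} (hd : 0 ≤ d) (hα₀ : 0 ≤ α₀) (hα₂ : 0 < α₂)
    (h₈ : 8 * α₂ ≤ 1) (h₅₀ : 50 * d * (α₀ + α₂) ≤ 1) : SectGSimplificationPrinted d α₀ α₂ := by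
  rw [sectG_simplification_iff hα₂]
  refine ⟨h₈, ?_⟩
  nlinarith [mul_nonneg (mul_nonneg hd hα₂.le) (sub_nonneg.2 h₈), mul_nonneg hd hα₀, mul_nonneg hd hα₂.le]

/-! ## §4 The bundle of block 04 (pp. 96–101) keyed to the consumer -/

/-- **BLOCK 04 OF [Balaban1985RegularSpaces] IN HYPOTHESIS FORM** — the printed statements of pp. 96–101 conjoined BY NAME over the
carriers of record: Sect. F's removal statement (`SectFRemovalPrinted`, on the `B8.GFData` part of the gauge-fixing family `fam`),
**Proposition 6** p. 99 (`B8.Prop6Printed d L B₁ c₁ famC`, cube-local family `famC`), **Proposition 7** p. 100 with its printed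
hypotheses (1.139)–(1.140) (`B8SectGH.Prop7PrintedR fam toAxial`), **Theorem 8** p. 101 at one γ («e.g. γ = 1») with the membership
f ∈ R(U₀) (`B8SectGH.Thm8PrintedAt γ B₁ B₂ fam`).  ONE constant `B₁` serves (1.136) («7dL²B₁Mα₀», B₁ the constant of Theorem 2) and
Theorem 8 (p. 101 ll. 14–15 «The constants B₁, B₂(β₀) are as in Theorems 2, 4»); `c₁` is Theorem 2/4's threshold entering Proposition 6
(«let 7dL²Mα₀ ≤ c₁»), Theorem 8's own threshold («c₁ depends on d, L and γ») is existential inside `Thm8PrintedAt`.  A node prover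
takes `(h : Hyp d L B₁ B₂ c₁ γ famC fam toAxial)`; the PROVED rows of these pages (module docstring, § IN TREE) need no
slot. [cite: Balaban1985RegularSpaces, Sect. F p.97–99 + Prop. 6 p.99 + Prop. 7 p.100 + Thm 8 p.101 (bundle by name)] -/
def Hyp {I J : Type} (d : ℕ) (L B₁ B₂ c₁ γ : ℝ) (famC : I → B8.CubeData)
    (fam : J → B8SectGH.GFData3) (toAxial : ∀ j, (fam j).Cfg → (fam j).Pert → (fam j).Pert) : Prop :=
  SectFRemovalPrinted (fun j => (fam j).toGFData) ∧
    B8.Prop6Printed d L B₁ c₁ famC ∧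
    B8SectGH.Prop7PrintedR fam toAxial ∧
    B8SectGH.Thm8PrintedAt γ B₁ B₂ fam

namespace Hyp

variable {J : Type} {d : ℕ} {L B₁ B₂ c₁ γ : ℝ} {famC : I → B8.CubeData} {fam : J → B8SectGH.GFData3}
  {toAxial : ∀ j, (fam j).Cfg → (fam j).Pert → (fam j).Pert}

/-- Accessor: Sect. F's removal statement. [cite: Balaban1985RegularSpaces, Sect. F p.99 ll.17–20] -/
theorem sectF (h : Hyp d L B₁ B₂ c₁ γ famC fam toAxial) :
    SectFRemovalPrinted (fun j => (fam j).toGFData) := h.1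

/-- Accessor: Proposition 6 (p. 99) by name. [cite: Balaban1985RegularSpaces, Prop. 6 (1.135)–(1.138) p.99] -/
theorem prop6 (h : Hyp d L B₁ B₂ c₁ γ famC fam toAxial) : B8.Prop6Printed d L B₁ c₁ famC := h.2.1

/-- Accessor: Proposition 7 (p. 100) with the printed hypotheses, by name. [cite: Balaban1985RegularSpaces, Prop. 7 (1.144)–(1.145) p.100] -/
theorem prop7 (h : Hyp d L B₁ B₂ c₁ γ famC fam toAxial) : B8SectGH.Prop7PrintedR fam toAxial := h.2.2.1

/-- Accessor: Theorem 8 (p. 101) at γ, by name. [cite: Balaban1985RegularSpaces, Thm 8 (1.146) p.101] -/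
theorem thm8 (h : Hyp d L B₁ B₂ c₁ γ famC fam toAxial) : B8SectGH.Thm8PrintedAt γ B₁ B₂ fam := h.2.2.2

/-- Derived: Theorem 8 at γ with the (3.35) clause of (1.33) dropped (`thm8At_dropReg335` fed from the bundle).
[cite: Balaban1985RegularSpaces, Thm 8 p.101 with Sect. F p.99 l.20 (bookkeeping)] -/
theorem thm8_noReg335 (h : Hyp d L B₁ B₂ c₁ γ famC fam toAxial) :
    ∃ c₁' : ℝ, 0 < c₁' ∧
      ∀ j : J, ∀ α₀ α₁ : ℝ, 0 < α₀ → 0 < α₁ → α₀ + α₁ ≤ c₁' →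
        ∀ U₀ : (fam j).Cfg, ∀ U' : (fam j).Pert, ∀ f : (fam j).Src,
          (fam j).InA α₀ U₀ → (fam j).InAAx α₀ U₀ U' → (fam j).avgClose α₁ U₀ U' →
          (fam j).InR U₀ f → (fam j).fNorm f < γ * (α₀ + α₁) →
            ∃ u : (fam j).GT, (fam j).Restricted U₀ u ∧
              ((fam j).C136 B₁ B₂ (α₀ + α₁) U₀ ((fam j).act U' u) ∧ (fam j).C137 α₁ U₀ ((fam j).act U' u) ∧
                (fam j).C139 B₁ (α₀ + α₁) U₀ ((fam j).act U' u) ∧ (fam j).LandauF U₀ f ((fam j).act U' u)) ∧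
              ∀ u' : (fam j).GT, (fam j).Restricted U₀ u' →
                (fam j).C136 B₁ B₂ (α₀ + α₁) U₀ ((fam j).act U' u') → (fam j).C137 α₁ U₀ ((fam j).act U' u') →
                (fam j).C139 B₁ (α₀ + α₁) U₀ ((fam j).act U' u') → (fam j).LandauF U₀ f ((fam j).act U' u') →
                  u' = u :=
  thm8At_dropReg335 γ B₁ B₂ fam h.thm8 h.sectF

/-- Derived: with Theorem 2 of block 02 (`B8.Thm2Printed` on the same family, p. 83) the bundle gives Theorem 2 with the (3.35)
clause dropped (`thm2_dropReg335`). [cite: Balaban1985RegularSpaces, Thm 2 p.83 with Sect. F p.99 l.20 (bookkeeping)] -/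
theorem thm2_noReg335 (h : Hyp d L B₁ B₂ c₁ γ famC fam toAxial)
    (h2 : B8.Thm2Printed (fun j => (fam j).toGFData)) :
    ∃ B₁' B₂' c₁' : ℝ, 0 < B₁' ∧ 0 < B₂' ∧ 0 < c₁' ∧
      ∀ j : J, ∀ α₀ α₁ : ℝ, 0 < α₀ → 0 < α₁ → α₀ + α₁ ≤ c₁' →
        ∀ U₀ : (fam j).Cfg, ∀ U' : (fam j).Pert,
          (fam j).InA α₀ U₀ → (fam j).InAAx α₀ U₀ U' → (fam j).avgClose α₁ U₀ U' →
            ∃ u : (fam j).GT, (fam j).Restricted U₀ u ∧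
              ((fam j).C136 B₁' B₂' (α₀ + α₁) U₀ ((fam j).act U' u) ∧ (fam j).C137 α₁ U₀ ((fam j).act U' u) ∧
                (fam j).Landau U₀ ((fam j).act U' u) ∧ (fam j).C139 B₁' (α₀ + α₁) U₀ ((fam j).act U' u)) ∧
              ∀ u' : (fam j).GT, (fam j).Restricted U₀ u' →
                (fam j).C136 B₁' B₂' (α₀ + α₁) U₀ ((fam j).act U' u') → (fam j).C137 α₁ U₀ ((fam j).act U' u') →
                (fam j).Landau U₀ ((fam j).act U' u') → (fam j).C139 B₁' (α₀ + α₁) U₀ ((fam j).act U' u') →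
                  u' = u :=
  thm2_dropReg335 (fun j => (fam j).toGFData) h2 h.sectF

end Hyp

end Literature.MathematicalPhysics.QuantumFieldTheory.Balaban1983to89.B8Carve04Props6to8Hyp
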